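import Mathlib
import HarnessLib

/-!
# Route `KLProgramme` — ENGINE (stmt-HubbardSuperconductivity-20437 `KLRegimeEngineV17F2`), located #25 «(b)-PLAIN-UV-TAIL», cure (α),
# E1 item (i), toolkit: CYCLIC SUMMATION BY PARTS ON `ℤ_N`, THE ROOT-OF-UNITY GAP, AND THE DISCRETE `L¹` LEMMA
# (cell gate-hubbard-kl, seat hubbard-kl-k3c2-p2 g35)

Three model-free finite-sum tools for the β/M-free bound on the one-leg mass `A(c) = N⁻¹Σ_{j ∈ ℤ_N}|Σ_{v ∈ ℤ_N} c(v) z_j^v|`, `z_j = e^{−2πij/N}`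
(sequel `…CutCurrencyLegMass`; factorisation `Θ ≤ A⁴` in `…CutCurrencyFactorisation`):
* §1 `klct_cyclic_sbp`, `klct_cyclic_sbp_two`, **`klct_normSq_mul_norm_sum_le_secondDiff`** — for `z^N = 1`,
  `(z−1)·Σ_v f(v)z^v = Σ_v (f(v−1) − f(v))z^v`, hence `|z−1|²·|Σ_v f(v) z^v| ≤ Σ_v |f(v−1−1) − 2f(v−1) + f(v)|` (cyclic second differences);
* §2 **`klct_rootOfUnity_gap`** — `|e^{−2πij/N} − 1| ≥ 4·min(j, N−j)/N` (`sin x ≥ 2x/π` on `[0, π/2]`);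
* §3 **`klct_sum_le_of_sq_decay`** — if `0 ≤ h ≤ S` on `ℤ_N` and `h(j)·min(j,N−j)² ≤ K` for `j ≠ 0`, then `Σ_j h(j) ≤ S(2J+1) + 2K/J` for every `J ≥ 1`
  (split at distance `J`; tail `Σ_{d>J} d⁻² ≤ 1/J` by telescoping, `klct_sum_inv_sq_tail_le`).
Pure finite-sum algebra / one trigonometric inequality; no definition; nothing asserts any row, (b), (C), K3, U₀, the window or superconductivity.
References: Zygmund, Trigonometric Series I §II.2 (Abel summation) [folklore]; BGM 2006 §2.3 [cite: BenfattoGiulianiMastropietro2006].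
-/

noncomputable section

namespace Summit.HubbardSuperconductivity.HubbardSuperconductivity.Theorems.KLRegimeSplit

set_option linter.dupNamespace false -- summit = problem name (single-conjunct summit), D-0017

open Finset

variable {N : ℕ} [NeZero N]

/-! ## §1 Cyclic summation by parts on `ℤ_N` -/

/-- Powers of an `N`-th root of unity read the cyclic successor: `z^{val(v+1)} = z^{val v + 1}`. -/
theorem klct_pow_val_add_one (z : ℂ) (hz : z ^ N = 1) (v : Fin N) : z ^ (((v + 1 : Fin N)) : ℕ) = z ^ ((v : ℕ) + 1) := by
  rw [Fin.val_add, ← pow_eq_pow_mod _ hz, pow_add, pow_add, pow_one, Fin.val_one', ← pow_eq_pow_mod _ hz, pow_one]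

/-- The shifted sum: `Σ_v f(v) z^{v+1} = Σ_v f(v−1) z^v` on `ℤ_N` (`z^N = 1`). -/
theorem klct_cyclic_shift_sum (f : Fin N → ℂ) (z : ℂ) (hz : z ^ N = 1) :
    ∑ v : Fin N, f v * z ^ ((v : ℕ) + 1) = ∑ v : Fin N, f (v - 1) * z ^ (v : ℕ) := by
  refine Fintype.sum_bijective (fun u : Fin N => u + 1) (Equiv.addRight (1 : Fin N)).bijective _ _ (fun u => ?_)
  simp only [add_sub_cancel_right]
  rw [klct_pow_val_add_one z hz u]

/-- **Cyclic summation by parts**: `(z − 1)·Σ_v f(v) z^v = Σ_v (f(v−1) − f(v)) z^v` for `z^N = 1`. -/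
theorem klct_cyclic_sbp (f : Fin N → ℂ) (z : ℂ) (hz : z ^ N = 1) :
    (z - 1) * ∑ v : Fin N, f v * z ^ (v : ℕ) = ∑ v : Fin N, (f (v - 1) - f v) * z ^ (v : ℕ) := by
  rw [sub_mul, one_mul, Finset.mul_sum]
  have h1 : ∑ v : Fin N, z * (f v * z ^ (v : ℕ)) = ∑ v : Fin N, f v * z ^ ((v : ℕ) + 1) :=
    Finset.sum_congr rfl (fun v _ => by rw [pow_succ]; ring)
  rw [h1, klct_cyclic_shift_sum f z hz, ← Finset.sum_sub_distrib]
  exact Finset.sum_congr rfl (fun v _ => by ring)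

/-- **Twice**: `(z − 1)²·Σ_v f(v) z^v = Σ_v (f(v−1−1) − 2f(v−1) + f(v)) z^v` for `z^N = 1`. -/
theorem klct_cyclic_sbp_two (f : Fin N → ℂ) (z : ℂ) (hz : z ^ N = 1) :
    (z - 1) ^ 2 * ∑ v : Fin N, f v * z ^ (v : ℕ) = ∑ v : Fin N, (f (v - 1 - 1) - 2 * f (v - 1) + f v) * z ^ (v : ℕ) := by
  rw [pow_two, mul_assoc, klct_cyclic_sbp f z hz, klct_cyclic_sbp (fun v => f (v - 1) - f v) z hz]
  exact Finset.sum_congr rfl (fun v _ => by ring)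

omit [NeZero N] in
/-- An `N`-th root of unity (`N ≠ 0`) is unimodular. -/
theorem klct_norm_eq_one_of_pow_eq_one (hN : N ≠ 0) {z : ℂ} (hz : z ^ N = 1) : ‖z‖ = 1 := by
  have h : ‖z‖ ^ N = 1 := by rw [← norm_pow, hz, norm_one]
  exact (pow_eq_one_iff_of_nonneg (norm_nonneg z) hN).mp h

/-- **The second-difference bound**: `|z − 1|²·|Σ_v f(v) z^v| ≤ Σ_v |f(v−1−1) − 2f(v−1) + f(v)|` for `z^N = 1`. -/
theorem klct_normSq_mul_norm_sum_le_secondDiff (f : Fin N → ℂ) (z : ℂ) (hz : z ^ N = 1) :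
    ‖z - 1‖ ^ 2 * ‖∑ v : Fin N, f v * z ^ (v : ℕ)‖ ≤ ∑ v : Fin N, ‖f (v - 1 - 1) - 2 * f (v - 1) + f v‖ := by
  have hz1 : ‖z‖ = 1 := klct_norm_eq_one_of_pow_eq_one (NeZero.ne N) hz
  rw [← norm_pow, ← norm_mul, klct_cyclic_sbp_two f z hz]
  refine (norm_sum_le _ _).trans (le_of_eq (Finset.sum_congr rfl (fun v _ => ?_)))
  rw [norm_mul, norm_pow, hz1, one_pow, mul_one]

/-- The same with the FIRST difference only (one summation by parts): `|z − 1|·|Σ_v f(v) z^v| ≤ Σ_v |f(v−1) − f(v)|`. -/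
theorem klct_norm_mul_norm_sum_le_firstDiff (f : Fin N → ℂ) (z : ℂ) (hz : z ^ N = 1) :
    ‖z - 1‖ * ‖∑ v : Fin N, f v * z ^ (v : ℕ)‖ ≤ ∑ v : Fin N, ‖f (v - 1) - f v‖ := by
  have hz1 : ‖z‖ = 1 := klct_norm_eq_one_of_pow_eq_one (NeZero.ne N) hz
  rw [← norm_mul, klct_cyclic_sbp f z hz]
  refine (norm_sum_le _ _).trans (le_of_eq (Finset.sum_congr rfl (fun v _ => ?_)))
  rw [norm_mul, norm_pow, hz1, one_pow, mul_one]

/-! ## §2 The root-of-unity gap -/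

/-- `e^{−2πij/N}` is an `N`-th root of unity. -/
theorem klct_rootOfUnity_pow (j : ℕ) : Complex.exp (-((2 * Real.pi * (j : ℝ) / N : ℝ) : ℂ) * Complex.I) ^ N = 1 := by
  have hN : (N : ℂ) ≠ 0 := by exact_mod_cast NeZero.ne N
  rw [← Complex.exp_nat_mul]
  have h : (N : ℂ) * (-((2 * Real.pi * (j : ℝ) / N : ℝ) : ℂ) * Complex.I) = ((-(j : ℤ) : ℤ) : ℂ) * (2 * Real.pi * Complex.I) := by
    push_cast; field_simp
  rw [h, Complex.exp_int_mul_two_pi_mul_I]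

omit [NeZero N] in
/-- The leg phase is a power of the root of unity: `e^{−2πi v j/N} = (e^{−2πij/N})^v`. -/
theorem klct_legPhase_eq_pow (v j : ℕ) :
    Complex.exp (-((2 * Real.pi * (v : ℝ) * (j : ℝ) / N : ℝ) : ℂ) * Complex.I) = Complex.exp (-((2 * Real.pi * (j : ℝ) / N : ℝ) : ℂ) * Complex.I) ^ v := by
  rw [← Complex.exp_nat_mul]
  congr 1
  push_cast
  ring

omit [NeZero N] in
/-- **ROOT-OF-UNITY GAP**: `|e^{−2πij/N} − 1| ≥ 4·min(j, N − j)/N` for `j < N` (`|e^{iθ} − 1| = 2|sin(θ/2)|` and `sin x ≥ 2x/π` on `[0, π/2]`). -/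
theorem klct_rootOfUnity_gap (hN : 0 < N) {j : ℕ} (hj : j < N) :
    4 * (min (j : ℝ) ((N : ℝ) - j)) / N ≤ ‖Complex.exp (-((2 * Real.pi * (j : ℝ) / N : ℝ) : ℂ) * Complex.I) - 1‖ := by
  have hNr : (0 : ℝ) < N := by exact_mod_cast hN
  have hx : (-((2 * Real.pi * (j : ℝ) / N : ℝ) : ℂ) * Complex.I) = Complex.I * (((-(2 * Real.pi * (j : ℝ) / N)) : ℝ) : ℂ) := by push_cast; ring
  rw [hx, Complex.norm_exp_I_mul_ofReal_sub_one, Real.norm_eq_abs, abs_mul, abs_two,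
    show (-(2 * Real.pi * (j : ℝ) / N)) / 2 = -(Real.pi * j / N) by ring, Real.sin_neg, abs_neg]
  have hpi := Real.pi_pos
  -- `θ = π j / N ∈ [0, π)`
  by_cases hjN : 2 * (j : ℝ) ≤ N
  · -- `θ ≤ π/2`
    have hθ0 : 0 ≤ Real.pi * j / N := by positivity
    have hθ1 : Real.pi * j / N ≤ Real.pi / 2 := by
      rw [div_le_div_iff₀ hNr two_pos]; nlinarith
    have hs := Real.mul_le_sin hθ0 hθ1
    rw [abs_of_nonneg ((by positivity : (0:ℝ) ≤ 2 / Real.pi * (Real.pi * j / N)).trans hs)]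
    have hmin : min (j : ℝ) ((N : ℝ) - j) ≤ j := min_le_left _ _
    calc 4 * min (j : ℝ) ((N : ℝ) - j) / N ≤ 4 * (j : ℝ) / N := by gcongr
      _ = 2 * (2 / Real.pi * (Real.pi * j / N)) := by field_simp; ring
      _ ≤ 2 * Real.sin (Real.pi * j / N) := by gcongr
  · push Not at hjN
    -- `θ > π/2`: use `sin θ = sin (π − θ)` with `π − θ = π (N − j)/N ∈ (0, π/2)`
    have hrefl : Real.sin (Real.pi * j / N) = Real.sin (Real.pi * ((N : ℝ) - j) / N) := by
      rw [← Real.sin_pi_sub]; congr 1; field_simp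
    rw [hrefl]
    have hjle : (j : ℝ) ≤ N := by exact_mod_cast hj.le
    have hθ0 : 0 ≤ Real.pi * ((N : ℝ) - j) / N := by apply div_nonneg _ hNr.le; nlinarith
    have hθ1 : Real.pi * ((N : ℝ) - j) / N ≤ Real.pi / 2 := by
      rw [div_le_div_iff₀ hNr two_pos]; nlinarith
    have hs := Real.mul_le_sin hθ0 hθ1
    rw [abs_of_nonneg ((by positivity : (0:ℝ) ≤ 2 / Real.pi * (Real.pi * ((N : ℝ) - j) / N)).trans hs)]
    have hmin : min (j : ℝ) ((N : ℝ) - j) ≤ (N : ℝ) - j := min_le_right _ _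
    calc 4 * min (j : ℝ) ((N : ℝ) - j) / N ≤ 4 * ((N : ℝ) - j) / N := by gcongr
      _ = 2 * (2 / Real.pi * (Real.pi * ((N : ℝ) - j) / N)) := by field_simp; ring
      _ ≤ 2 * Real.sin (Real.pi * ((N : ℝ) - j) / N) := by gcongr

/-! ## §3 The discrete `L¹` lemma -/

/-- Telescoping tail: `Σ_{v < J+1+m, J < v} v⁻² ≤ 1/J − 1/(J+m)` (`J ≥ 1`). -/
theorem klct_sum_inv_sq_tail_aux {J : ℕ} (hJ : 1 ≤ J) (m : ℕ) :
    ∑ v ∈ range (J + 1 + m), (if J < v then ((v : ℝ) ^ 2)⁻¹ else 0) ≤ 1 / (J : ℝ) - 1 / ((J : ℝ) + m) := by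
  induction m with
  | zero =>
    rw [Finset.sum_eq_zero (fun v hv => by rw [if_neg (by have := Finset.mem_range.mp hv; omega)])]
    simp
  | succ m ih =>
    rw [show J + 1 + (m + 1) = (J + 1 + m) + 1 by ring, Finset.sum_range_succ, if_pos (by omega)]
    have hJr : (1 : ℝ) ≤ J := by exact_mod_cast hJ
    have hkey : (((J + 1 + m : ℕ) : ℝ) ^ 2)⁻¹ ≤ 1 / ((J : ℝ) + m) - 1 / ((J : ℝ) + (m + 1 : ℕ)) := by
      have ha : (0 : ℝ) < (J : ℝ) + m := by positivity
      rw [div_sub_div _ _ ha.ne' (by positivity), inv_eq_one_div, div_le_div_iff₀ (by positivity) (by positivity)]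
      push_cast
      nlinarith
    push_cast at hkey ⊢
    linarith

/-- **Tail of `Σ v⁻²`**: `Σ_{v < n, J < v} v⁻² ≤ 1/J` for `J ≥ 1`. -/
theorem klct_sum_inv_sq_tail_le {J : ℕ} (hJ : 1 ≤ J) (n : ℕ) :
    ∑ v ∈ range n, (if J < v then ((v : ℝ) ^ 2)⁻¹ else 0) ≤ 1 / (J : ℝ) := by
  by_cases hn : n ≤ J + 1
  · rw [Finset.sum_eq_zero (fun v hv => by rw [if_neg (by have := Finset.mem_range.mp hv; omega)])]
    positivity
  · obtain ⟨m, rfl⟩ : ∃ m, n = J + 1 + m := ⟨n - (J + 1), by omega⟩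
    refine (klct_sum_inv_sq_tail_aux hJ m).trans ?_
    have : 0 ≤ 1 / ((J : ℝ) + m) := by positivity
    linarith

omit [NeZero N] in
/-- **THE DISCRETE `L¹` LEMMA.**  Let `h : ℤ_N → ℝ` with `h ≤ S` everywhere (`0 ≤ S`) and `h(j)·min(j, N−j)² ≤ K` for `j ≠ 0` (`0 ≤ K`).
Then for every integer `J ≥ 1`: `Σ_j h(j) ≤ S·(2J+1) + 2K/J` (near part: at most `2J+1` points; far part: `h ≤ K/d²` and `Σ_{d>J} d⁻² ≤ 1/J` on both sides). -/
theorem klct_sum_le_of_sq_decay (h : Fin N → ℝ) {S K : ℝ} (hS : 0 ≤ S) (hK : 0 ≤ K) (hle : ∀ j, h j ≤ S)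
    (hdec : ∀ j : Fin N, (j : ℕ) ≠ 0 → h j * (min (j : ℝ) ((N : ℝ) - j)) ^ 2 ≤ K) {J : ℕ} (hJ : 1 ≤ J) :
    ∑ j : Fin N, h j ≤ S * (2 * J + 1) + 2 * K / J := by
  classical
  -- pass to a sum over `range N`
  set h' : ℕ → ℝ := fun v => if hv : v < N then h ⟨v, hv⟩ else 0 with hh'
  have hsum : ∑ j : Fin N, h j = ∑ v ∈ range N, h' v := by
    rw [← Fin.sum_univ_eq_sum_range]
    exact Finset.sum_congr rfl (fun j _ => by simp [hh', j.isLt])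
  rw [hsum]
  -- the pointwise majorant
  set b : ℕ → ℝ := fun v => (if v ≤ J then S else 0) + (if N ≤ v + J then S else 0) +
      K * (if J < v then ((v : ℝ) ^ 2)⁻¹ else 0) + K * (if J < N - v then (((N - v : ℕ) : ℝ) ^ 2)⁻¹ else 0) with hb
  have hpt : ∀ v ∈ range N, h' v ≤ b v := by
    intro v hv
    have hvN : v < N := Finset.mem_range.mp hv
    have hv' : h' v = h ⟨v, hvN⟩ := by simp [hh', hvN]
    rw [hv']
    have t1 : 0 ≤ (if v ≤ J then S else 0) := by split_ifs <;> linarith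
    have t2 : 0 ≤ (if N ≤ v + J then S else 0) := by split_ifs <;> linarith
    have t3 : 0 ≤ K * (if J < v then ((v : ℝ) ^ 2)⁻¹ else 0) := by apply mul_nonneg hK; split_ifs <;> positivity
    have t4 : 0 ≤ K * (if J < N - v then (((N - v : ℕ) : ℝ) ^ 2)⁻¹ else 0) := by apply mul_nonneg hK; split_ifs <;> positivity
    by_cases hvJ : v ≤ J
    · have := hle ⟨v, hvN⟩
      simp only [hb, if_pos hvJ]; linarith
    by_cases hvJ' : N ≤ v + J
    · have := hle ⟨v, hvN⟩
      simp only [hb, if_pos hvJ']; linarith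
    -- far from `0` on both sides: `h ≤ K / min²`
    push Not at hvJ hvJ'
    have hv0 : v ≠ 0 := by omega
    have hd := hdec ⟨v, hvN⟩ (by simpa using hv0)
    by_cases hside : 2 * v ≤ N
    · have hmin : min (v : ℝ) ((N : ℝ) - v) = v := by
        apply min_eq_left; have : ((2 * v : ℕ) : ℝ) ≤ N := by exact_mod_cast hside
        push_cast at this; linarith
      rw [hmin] at hd
      have hvpos : (0 : ℝ) < (v : ℝ) ^ 2 := by have : (0:ℝ) < v := by exact_mod_cast Nat.pos_of_ne_zero hv0
                                               positivity
      have hq : h ⟨v, hvN⟩ ≤ K * ((v : ℝ) ^ 2)⁻¹ := by rw [← div_eq_mul_inv, le_div_iff₀ hvpos]; exact hd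
      simp only [hb, if_pos hvJ]; linarith
    · have hmin : min (v : ℝ) ((N : ℝ) - v) = (N : ℝ) - v := by
        apply min_eq_right; push Not at hside
        have : (N : ℝ) < ((2 * v : ℕ) : ℝ) := by exact_mod_cast hside
        push_cast at this; linarith
      rw [hmin] at hd
      have hNv : ((N - v : ℕ) : ℝ) = (N : ℝ) - v := by rw [Nat.cast_sub hvN.le]
      have hvpos : (0 : ℝ) < ((N : ℝ) - v) ^ 2 := by have : (0:ℝ) < (N : ℝ) - v := by have : ((v : ℕ) : ℝ) < N := by exact_mod_cast hvN
                                                                                      linarith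
                                                     positivity
      have hq : h ⟨v, hvN⟩ ≤ K * (((N - v : ℕ) : ℝ) ^ 2)⁻¹ := by rw [hNv, ← div_eq_mul_inv, le_div_iff₀ hvpos]; exact hd
      have h4 : J < N - v := by omega
      simp only [hb, if_pos h4]; linarith
  refine (Finset.sum_le_sum hpt).trans ?_
  -- sum the majorant
  simp only [hb, Finset.sum_add_distrib, ← Finset.mul_sum]
  have hJr : (0 : ℝ) < J := by exact_mod_cast hJ
  -- (1) `#{v < N : v ≤ J} ≤ J + 1`
  have s1 : ∑ v ∈ range N, (if v ≤ J then S else 0) ≤ S * (J + 1) := by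
    rw [Finset.sum_ite, Finset.sum_const_zero, add_zero, Finset.sum_const, nsmul_eq_mul, mul_comm]
    gcongr
    have hsub : (range N).filter (fun v => v ≤ J) ⊆ range (J + 1) := by
      intro v hv; simp only [Finset.mem_filter, Finset.mem_range] at hv ⊢; omega
    have := Finset.card_le_card hsub
    rw [Finset.card_range] at this
    exact_mod_cast this
  -- (2) `#{v < N : N ≤ v + J} ≤ J`
  have s2 : ∑ v ∈ range N, (if N ≤ v + J then S else 0) ≤ S * J := by
    rw [Finset.sum_ite, Finset.sum_const_zero, add_zero, Finset.sum_const, nsmul_eq_mul, mul_comm]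
    gcongr
    have hsub : (range N).filter (fun v => N ≤ v + J) ⊆ Finset.Ico (N - J) N := by
      intro v hv; simp only [Finset.mem_filter, Finset.mem_range, Finset.mem_Ico] at hv ⊢; omega
    have hcard : ((range N).filter (fun v => N ≤ v + J)).card ≤ J := by
      have := Finset.card_le_card hsub
      rw [Nat.card_Ico] at this
      omega
    exact_mod_cast hcard
  -- (3) the right tail
  have s3 : K * ∑ v ∈ range N, (if J < v then ((v : ℝ) ^ 2)⁻¹ else 0) ≤ K * (1 / J) :=
    mul_le_mul_of_nonneg_left (klct_sum_inv_sq_tail_le hJ N) hK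
  -- (4) the left tail, reflected
  have s4 : K * ∑ v ∈ range N, (if J < N - v then (((N - v : ℕ) : ℝ) ^ 2)⁻¹ else 0) ≤ K * (1 / J) := by
    refine mul_le_mul_of_nonneg_left ?_ hK
    have hrefl : ∑ v ∈ range N, (if J < N - v then (((N - v : ℕ) : ℝ) ^ 2)⁻¹ else 0) =
        ∑ v ∈ range N, (if J < v + 1 then (((v + 1 : ℕ) : ℝ) ^ 2)⁻¹ else 0) := by
      rw [← Finset.sum_range_reflect (fun v => (if J < v + 1 then (((v + 1 : ℕ) : ℝ) ^ 2)⁻¹ else 0)) N]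
      refine Finset.sum_congr rfl (fun v hv => ?_)
      have hvN := Finset.mem_range.mp hv
      have : N - 1 - v + 1 = N - v := by omega
      simp only [this]
    rw [hrefl]
    have hshift : ∑ v ∈ range N, (if J < v + 1 then (((v + 1 : ℕ) : ℝ) ^ 2)⁻¹ else 0) ≤
        ∑ v ∈ range (N + 1), (if J < v then ((v : ℝ) ^ 2)⁻¹ else 0) := by
      rw [Finset.sum_range_succ']
      simp only [show ¬ J < 0 from Nat.not_lt_zero J, if_false, add_zero]
      push_cast
      exact le_rfl
    exact hshift.trans (klct_sum_inv_sq_tail_le hJ (N + 1))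
  have htot : S * (J + 1) + S * J + K * (1 / J) + K * (1 / J) = S * (2 * J + 1) + 2 * K / J := by field_simp; ring
  linarith [s1, s2, s3, s4]

end Summit.HubbardSuperconductivity.HubbardSuperconductivity.Theorems.KLRegimeSplit

end
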